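import Summits.Ventures.PercRepro.S1CoreCapSixCost

/-!
# PercRepro — TOWARDS `Q*(6) = 16`: TWO SIMPLE 4-POINT LINES (p1, gen 25)

The case of exactly two lines of `≥ 4` points, both simple 4-point lines `L₁, L₂` (cost `2 + 2`), the other
lines `T` being 3-point lines. Over `P₀ = L₂ ∪ L₁` the family `T` has BUDGET `2`: `freeCountR P₀ l + fat ≤ 2`
for every list (`budget_two`); no line of `T` is covered by `P₀` (`≤ 1` point on each of `L₁, L₂`). A line of `T`
is a CHORD when it has exactly one point off `P₀` (its HUB) and then one point on each of `L₁ ∖ L₂`, `L₂ ∖ L₁`;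
chords with a common hub have distinct points on `L₁ ∖ L₂` (`card_chords_le`). With a fat point `v` every line
passes through `v` and is a chord (a line missing `v` or a second new point costs one unit too many), so the cap
sum is `≤ 8 + 2 · |L₁ ∖ L₂| ≤ 16` (`sum_cap_le_of_fat`). With no fat point the non-chords (`≤ 1` point on `P₀`)
number `≤ 3` by the counting lemma at budget `2`, and the chords: two chords with distinct hubs `n ≠ m` cover every
other line (`subset_of_free_le_two`), so every further line has its new points among `n, m` — at most one
non-chord and `≤ |L₁ ∖ L₂|` chords per hub; if all chords share a hub there are `≤ |L₁ ∖ L₂|` of them. Hence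
`#T ≤ 2 · |L₁ ∖ L₂| + 1 ≤ 7` when `L₁ ∩ L₂ ≠ ∅`; when `L₁ ∩ L₂ = ∅` any two lines of `T` placed before `L₁, L₂`
spend the budget (`1 + 1 + 2 + 2`), so every third line is covered by them (`subset_of_disjoint`) and two chords
with a common hub force every line through that hub: `#T ≤ 4`. In all cases the cap sum is `≤ 16`
(`sum_cap_le_sixteen_of_two_four`). `proofs/P1-S4-CAPBRIDGE.md` §17. Axioms: standard.
-/

namespace PercRepro

namespace S1

namespace FourCap

variable {β : Type} [DecidableEq β]

section TwoFour

variable {w : β → ℕ} {ls : Finset (Finset β)}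
  (h1 : ∀ L ∈ ls, ∀ v ∈ L, w v = 1 ∨ w v = 2)
  (h2 : ∀ L ∈ ls, 3 ≤ L.card ∧ wsum w L ≤ 5)
  (h3 : ∀ L ∈ ls, ∀ L' ∈ ls, L ≠ L' → (L ∩ L').card ≤ 1)
  (h4 : ∀ l : List (Finset β), l.Nodup → (∀ L ∈ l, L ∈ ls) → wsum w (unionL l) ≤ 6 + lineRank l)
  {L₁ L₂ : Finset β} (hL₁ : L₁ ∈ ls) (hL₂ : L₂ ∈ ls) (h12 : L₂ ≠ L₁)
  (c1 : L₁.card = 4) (c2 : L₂.card = 4) (f1 : fat w L₁ = 0) (f2 : fat w L₂ = 0)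
  (hrest : ∀ L ∈ ls, L ≠ L₁ → L ≠ L₂ → L.card = 3)

omit [DecidableEq β] in
/-- Every line of a configuration has at least two points (for `costSum_le`). -/
theorem two_le_card_of_spec' {w : β → ℕ} {ls : Finset (Finset β)}
    (h2 : ∀ L ∈ ls, 3 ≤ L.card ∧ wsum w L ≤ 5) : ∀ L ∈ ls, 2 ≤ L.card :=
  fun L hL => le_trans (by omega) (h2 L hL).1

include h1 hL₁ hL₂ f1 f2 in
/-- The points of `P₀ = L₂ ∪ L₁` are simple. -/
theorem weight_one_of_mem_two {v : β} (hv : v ∈ L₂ ∪ L₁) : w v = 1 := by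
  rcases Finset.mem_union.1 hv with h | h
  · exact weight_one_of_fat_zero (h1 L₂ hL₂) f2 h
  · exact weight_one_of_fat_zero (h1 L₁ hL₁) f1 h

include h1 hL₁ hL₂ f1 f2 in
/-- No fat point lies in `P₀`. -/
theorem fat_P₀_eq_zero : fat w (L₂ ∪ L₁) = 0 := by
  unfold fat
  rw [Finset.card_eq_zero, Finset.filter_eq_empty_iff]
  intro v hv
  have := weight_one_of_mem_two h1 hL₁ hL₂ f1 f2 hv
  omega

include h3 hL₁ hL₂ hrest in
/-- A line other than `L₁, L₂` is not covered by `P₀`: it has `≤ 1` point on each. -/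
theorem not_subset_P₀ {X : Finset β} (hX : X ∈ ls) (hX1 : X ≠ L₁) (hX2 : X ≠ L₂) : ¬ X ⊆ L₂ ∪ L₁ := by
  intro hsub
  have := Finset.card_le_card hsub
  have hc := hrest X hX hX1 hX2
  have hXU : X ∩ (L₂ ∪ L₁) = X := Finset.inter_eq_left.2 hsub
  have hle := card_inter_union_le X L₂ L₁
  rw [hXU] at hle
  have := h3 X hX L₂ hL₂ hX2
  have := h3 X hX L₁ hL₁ hX1
  omega

include h1 h2 h3 h4 hL₁ hL₂ h12 c1 c2 f1 f2 hrest in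
/-- **Budget `2` over `P₀ = L₂ ∪ L₁`**: every list of other lines has `freeCountR P₀ l + fat ≤ 2`. -/
theorem budget_two (l : List (Finset β)) (hnd : l.Nodup) (hl : ∀ L ∈ l, L ∈ ls ∧ L ≠ L₁ ∧ L ≠ L₂) :
    freeCountR (L₂ ∪ L₁) l + fat w (unionLR (L₂ ∪ L₁) l) ≤ 2 := by
  have hnd' : (l ++ [L₂, L₁]).Nodup := by
    refine List.Nodup.append hnd (by simp [h12]) ?_
    intro X hXl hX'
    simp only [List.mem_cons, List.not_mem_nil, or_false] at hX'
    rcases hX' with rfl | rfl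
    · exact (hl X hXl).2.2 rfl
    · exact (hl X hXl).2.1 rfl
  have hls : ∀ L ∈ l ++ [L₂, L₁], L ∈ ls := by
    intro L hL
    rcases List.mem_append.1 hL with h | h
    · exact (hl L h).1
    · simp only [List.mem_cons, List.not_mem_nil, or_false] at h
      rcases h with rfl | rfl
      · exact hL₂
      · exact hL₁
  have h := budget_of_prefix h1 (two_le_card_of_spec' h2) h4 [L₂, L₁] l hnd' hls
    (fun L hL => hrest L (hl L hL).1 (hl L hL).2.1 (hl L hL).2.2)
  simp only [costSum, unionL, Finset.union_empty, Nat.zero_add] at h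
  rw [lineCost_empty, lineCost_of_inter_le_two (le_trans (h3 L₂ hL₂ L₁ hL₁ h12) (by omega)), c1, c2, f1,
    fat_P₀_eq_zero h1 hL₁ hL₂ f1 f2] at h
  have : fat w (L₂ \ L₁) = 0 := by
    have := fat_mono w (Finset.sdiff_subset (s := L₂) (t := L₁)); omega
  omega

include h1 h2 h3 h4 hL₁ hL₂ h12 c1 c2 f1 f2 hrest in
/-- Every other line has at most one fat point. -/
theorem fat_le_one_of_two {X : Finset β} (hX : X ∈ ls) (hX1 : X ≠ L₁) (hX2 : X ≠ L₂) : fat w X ≤ 1 := by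
  have h := budget_two h1 h2 h3 h4 hL₁ hL₂ h12 c1 c2 f1 f2 hrest [X] (List.nodup_singleton X)
    (by simpa using ⟨hX, hX1, hX2⟩)
  have hns := not_subset_P₀ h3 hL₁ hL₂ hrest hX hX1 hX2
  simp only [freeCountR, unionLR, if_neg hns] at h
  have := fat_mono w (Finset.subset_union_left (s₁ := X) (s₂ := L₂ ∪ L₁))
  omega

/-- **A chord** (one point off `P₀`) has exactly one point on each of `L₁ ∖ L₂` and `L₂ ∖ L₁`. -/
theorem chord_inter {X : Finset β} (hX3 : X.card = 3) (hXP : (X \ (L₂ ∪ L₁)).card = 1)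
    (i1 : (X ∩ L₁).card ≤ 1) (i2 : (X ∩ L₂).card ≤ 1) :
    (X ∩ L₁).card = 1 ∧ (X ∩ L₂).card = 1 ∧ Disjoint (X ∩ L₁) L₂ := by
  have hsplit := Finset.card_sdiff_add_card_inter X (L₂ ∪ L₁)
  have hie := Finset.card_union_add_card_inter (X ∩ L₂) (X ∩ L₁)
  rw [← Finset.inter_union_distrib_left, Finset.inter_inter_inter_comm, Finset.inter_self] at hie
  have hd : Disjoint (X ∩ L₁) L₂ := by
    rw [Finset.disjoint_left]
    intro v hv hv2
    have hv1 := Finset.mem_inter.1 hv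
    have hmem : v ∈ X ∩ (L₂ ∩ L₁) := Finset.mem_inter.2 ⟨hv1.1, Finset.mem_inter.2 ⟨hv2, hv1.2⟩⟩
    have := Finset.card_pos.2 ⟨v, hmem⟩
    omega
  exact ⟨by omega, by omega, hd⟩

include h3 hL₁ hL₂ hrest in
/-- **Chords with a common hub inject into `L₁ ∖ L₂`** by their point on `L₁`. -/
theorem card_chords_le (v : β) :
    (((ls.erase L₁).erase L₂).filter (fun X => X \ (L₂ ∪ L₁) = {v})).card ≤ (L₁ \ L₂).card := by
  set C := ((ls.erase L₁).erase L₂).filter (fun X => X \ (L₂ ∪ L₁) = {v}) with hC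
  have hCmem : ∀ X ∈ C, X ∈ ls ∧ X ≠ L₁ ∧ X ≠ L₂ ∧ X \ (L₂ ∪ L₁) = {v} := by
    intro X hX
    rw [hC, Finset.mem_filter, Finset.mem_erase, Finset.mem_erase] at hX
    exact ⟨hX.1.2.2, hX.1.2.1, hX.1.1, hX.2⟩
  have hdata : ∀ X ∈ C, (X ∩ L₁).card = 1 ∧ (X ∩ L₂).card = 1 ∧ Disjoint (X ∩ L₁) L₂ := by
    intro X hX
    obtain ⟨hXls, hX1, hX2, hXv⟩ := hCmem X hX
    exact chord_inter (hrest X hXls hX1 hX2) (by rw [hXv]; simp) (h3 X hXls L₁ hL₁ hX1) (h3 X hXls L₂ hL₂ hX2)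
  have hinj : C.card ≤ ((L₁ \ L₂).powersetCard 1).card := by
    refine Finset.card_le_card_of_injOn (fun X => X ∩ L₁) ?_ ?_
    · intro X hX
      obtain ⟨i1, -, hd⟩ := hdata X hX
      refine Finset.mem_powersetCard.2 ⟨?_, i1⟩
      intro u hu
      exact Finset.mem_sdiff.2 ⟨(Finset.mem_inter.1 hu).2, fun h => Finset.disjoint_left.1 hd hu h⟩
    · intro X hX X' hX' hXX'
      simp only at hXX'
      obtain ⟨hXls, hX1, hX2, hXv⟩ := hCmem X (Finset.mem_coe.1 hX)
      obtain ⟨hX'ls, -, -, hX'v⟩ := hCmem X' (Finset.mem_coe.1 hX')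
      by_contra hne
      have hle := h3 X hXls X' hX'ls hne
      obtain ⟨i1, -, hd⟩ := hdata X (Finset.mem_coe.1 hX)
      -- `v` and the point of `X ∩ L₁` both lie in `X ∩ X'`
      have hvX : v ∈ X := (Finset.mem_sdiff.1 (hXv ▸ Finset.mem_singleton_self v)).1
      have hvX' : v ∈ X' := (Finset.mem_sdiff.1 (hX'v ▸ Finset.mem_singleton_self v)).1
      have hvP : v ∉ L₂ ∪ L₁ := (Finset.mem_sdiff.1 (hXv ▸ Finset.mem_singleton_self v)).2
      obtain ⟨a, ha⟩ := Finset.card_eq_one.1 i1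
      have haX : a ∈ X ∩ L₁ := ha ▸ Finset.mem_singleton_self a
      have haX' : a ∈ X' ∩ L₁ := hXX' ▸ haX
      have hav : a ≠ v := fun h => hvP (Finset.mem_union_right _ (h ▸ (Finset.mem_inter.1 haX).2))
      have hsub : {v, a} ⊆ X ∩ X' := by
        intro u hu
        rcases Finset.mem_insert.1 hu with rfl | hu
        · exact Finset.mem_inter.2 ⟨hvX, hvX'⟩
        · rw [Finset.mem_singleton.1 hu]
          exact Finset.mem_inter.2 ⟨(Finset.mem_inter.1 haX).1, (Finset.mem_inter.1 haX').1⟩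
      have := Finset.card_le_card hsub
      rw [Finset.card_pair hav.symm] at this
      omega
  rw [Finset.card_powersetCard, Nat.choose_one_right] at hinj
  exact hinj

include h1 h2 h3 h4 hL₁ hL₂ h12 c1 c2 f1 f2 hrest in
/-- **With a fat point `v` on `X`, every OTHER line is a chord through `v`**: a line `Y` missing `v` placed before
`X` leaves `X` free (cost `1 + 1 + 1`), and a second new point of `Y` makes `Y` free after `X`. -/
theorem chord_of_fat {X : Finset β} (hX : X ∈ ls) (hX1 : X ≠ L₁) (hX2 : X ≠ L₂) {v : β} (hvX : v ∈ X)
    (hv2 : w v = 2) {Y : Finset β} (hY : Y ∈ ls) (hY1 : Y ≠ L₁) (hY2 : Y ≠ L₂) (hXY : Y ≠ X) :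
    Y \ (L₂ ∪ L₁) = {v} := by
  have hvP : v ∉ L₂ ∪ L₁ := fun h => by have := weight_one_of_mem_two h1 hL₁ hL₂ f1 f2 h; omega
  have hnsX := not_subset_P₀ h3 hL₁ hL₂ hrest hX hX1 hX2
  have hnsY := not_subset_P₀ h3 hL₁ hL₂ hrest hY hY1 hY2
  -- the list `[X, Y]` (`Y` first): `Y` free, the fat point `v` in the union, so `X ⊆ Y ∪ P₀`
  have h := budget_two h1 h2 h3 h4 hL₁ hL₂ h12 c1 c2 f1 f2 hrest [X, Y] (by simp [Ne.symm hXY])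
    (by simp [hX, hX1, hX2, hY, hY1, hY2])
  simp only [freeCountR, unionLR, if_neg hnsY] at h
  have hfat : 1 ≤ fat w (X ∪ (Y ∪ (L₂ ∪ L₁))) := one_le_fat (Finset.mem_union_left _ hvX) hv2
  have hXsub : X ⊆ Y ∪ (L₂ ∪ L₁) := by
    by_contra hc
    simp [hc] at h
    omega
  have hvY : v ∈ Y := by
    rcases Finset.mem_union.1 (hXsub hvX) with h | h
    · exact h
    · exact absurd h hvP
  -- the list `[Y, X]` (`X` first): `X` free, `v` in the union, so `Y ⊆ X ∪ P₀`
  have h' := budget_two h1 h2 h3 h4 hL₁ hL₂ h12 c1 c2 f1 f2 hrest [Y, X] (by simp [hXY])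
    (by simp [hX, hX1, hX2, hY, hY1, hY2])
  simp only [freeCountR, unionLR, if_neg hnsX] at h'
  have hfat' : 1 ≤ fat w (Y ∪ (X ∪ (L₂ ∪ L₁))) :=
    one_le_fat (Finset.mem_union_right _ (Finset.mem_union_left _ hvX)) hv2
  have hYsub : Y ⊆ X ∪ (L₂ ∪ L₁) := by
    by_contra hc
    simp [hc] at h'
    omega
  have hle := h3 X hX Y hY (fun h => hXY h.symm)
  have hsub : Y \ (L₂ ∪ L₁) ⊆ X ∩ Y := by
    intro u hu
    have hu' := Finset.mem_sdiff.1 hu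
    rcases Finset.mem_union.1 (hYsub hu'.1) with h | h
    · exact Finset.mem_inter.2 ⟨h, hu'.1⟩
    · exact absurd h hu'.2
  have hvmem : v ∈ Y \ (L₂ ∪ L₁) := Finset.mem_sdiff.2 ⟨hvY, hvP⟩
  have hcard := Finset.card_le_card hsub
  rw [Finset.eq_singleton_iff_unique_mem]
  exact ⟨hvmem, fun u hu => Finset.card_le_one.1 (by omega) u hu v hvmem⟩

include h1 h2 h3 h4 hL₁ hL₂ h12 c1 c2 f1 f2 hrest in
/-- **With a fat point the cap sum is `≤ 16`**: at most one other line, or all lines chords through the fat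
point — at most `|L₁ ∖ L₂| ≤ 4` of them, each of cap `≤ 2`. -/
theorem sum_cap_le_of_fat {X : Finset β} (hX : X ∈ ls) (hX1 : X ≠ L₁) (hX2 : X ≠ L₂) {v : β} (hvX : v ∈ X)
    (hv2 : w v = 2) : ∑ L ∈ ls, capPaper L.card (fat w L) ≤ 16 := by
  set T := (ls.erase L₁).erase L₂ with hT
  have hTmem : ∀ Y ∈ T, Y ∈ ls ∧ Y ≠ L₁ ∧ Y ≠ L₂ := by
    intro Y hY
    rw [hT, Finset.mem_erase, Finset.mem_erase] at hY
    exact ⟨hY.2.2, hY.2.1, hY.1⟩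
  have hXT : X ∈ T := by rw [hT]; exact Finset.mem_erase.2 ⟨hX2, Finset.mem_erase.2 ⟨hX1, hX⟩⟩
  have hL₂' : L₂ ∈ ls.erase L₁ := Finset.mem_erase.2 ⟨h12, hL₂⟩
  rw [← Finset.add_sum_erase ls _ hL₁, ← Finset.add_sum_erase _ _ hL₂', ← hT, c1, c2, f1, f2]
  have hcap : ∀ Y ∈ T, capPaper Y.card (fat w Y) ≤ 2 := by
    intro Y hY
    obtain ⟨hYls, hY1, hY2⟩ := hTmem Y hY
    rw [hrest Y hYls hY1 hY2, capPaper_three_eq (fat_le_one_of_two h1 h2 h3 h4 hL₁ hL₂ h12 c1 c2 f1 f2 hrest hYls hY1 hY2)]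
    have := fat_le_one_of_two h1 h2 h3 h4 hL₁ hL₂ h12 c1 c2 f1 f2 hrest hYls hY1 hY2
    omega
  have hsum : ∑ Y ∈ T, capPaper Y.card (fat w Y) ≤ 2 * T.card := by
    calc ∑ Y ∈ T, capPaper Y.card (fat w Y) ≤ ∑ _Y ∈ T, 2 := Finset.sum_le_sum hcap
      _ = 2 * T.card := by rw [Finset.card_eq_sum_ones, Finset.mul_sum]; simp only [mul_one]
  have hTcard : T.card ≤ 4 := by
    rcases (by omega : T.card ≤ 1 ∨ 1 < T.card) with h | h
    · omega
    -- a second line `Y ≠ X` exists: every line is a chord through `v`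
    obtain ⟨Y₀, hY₀, hY₀X⟩ : ∃ Y ∈ T, Y ≠ X := by
      by_contra hc
      have : T ⊆ {X} := fun Y hY => Finset.mem_singleton.2 (by
        by_contra hne
        exact hc ⟨Y, hY, hne⟩)
      have := Finset.card_le_card this
      rw [Finset.card_singleton] at this
      omega
    obtain ⟨hY₀ls, hY₀1, hY₀2⟩ := hTmem Y₀ hY₀
    have hvY₀ : v ∈ Y₀ := by
      have := chord_of_fat h1 h2 h3 h4 hL₁ hL₂ h12 c1 c2 f1 f2 hrest hX hX1 hX2 hvX hv2 hY₀ls hY₀1 hY₀2 hY₀X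
      exact (Finset.mem_sdiff.1 (this ▸ Finset.mem_singleton_self v)).1
    have hall : ∀ Y ∈ T, Y \ (L₂ ∪ L₁) = {v} := by
      intro Y hY
      obtain ⟨hYls, hY1, hY2⟩ := hTmem Y hY
      by_cases hYX : Y = X
      · subst hYX
        exact chord_of_fat h1 h2 h3 h4 hL₁ hL₂ h12 c1 c2 f1 f2 hrest hY₀ls hY₀1 hY₀2 hvY₀ hv2 hYls hY1 hY2
          (fun h => hY₀X h.symm)
      · exact chord_of_fat h1 h2 h3 h4 hL₁ hL₂ h12 c1 c2 f1 f2 hrest hX hX1 hX2 hvX hv2 hYls hY1 hY2 hYX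
    have hTfilter : T = T.filter (fun Y => Y \ (L₂ ∪ L₁) = {v}) := by
      ext Y
      simp only [Finset.mem_filter]
      exact ⟨fun hY => ⟨hY, hall Y hY⟩, fun hY => hY.1⟩
    have hc := card_chords_le h3 hL₁ hL₂ hrest (ls := ls) (L₁ := L₁) (L₂ := L₂) v
    rw [← hT, ← hTfilter] at hc
    have : (L₁ \ L₂).card ≤ 4 := le_trans (Finset.card_le_card Finset.sdiff_subset) (by omega)
    omega
  have e : capPaper 4 0 = 4 := by decide
  rw [e]
  omega

end TwoFour

end FourCap

end S1

end PercRepro
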